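import Literature.MathematicalPhysics.QuantumLattice.TorusLimitOfMixtures
import Literature.MathematicalPhysics.QuantumLattice.HubbardOneBodyKinematicRows
import Literature.MathematicalPhysics.QuantumLattice.HubbardNNNHoppingWindowCertificate
import Literature.MathematicalPhysics.QuantumLattice.DuhamelTwoPoint
import Literature.Analysis.SpecialFunctions.LogChooseStirling
import Mathlib.Analysis.Complex.ExponentialBounds
import HarnessLib

/-!
# Canonical (sector) Gibbs states of the `t–t'` torus as finite mixtures, and the
# energy–entropy CAP `e_Φ(ω) ≤ e(t,t',U,n) + s/β` for their thermodynamic limits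

Family `hubbard` (topic `MathematicalPhysics/QuantumLattice`; companion of `TorusLimitOfMixtures`,
`HubbardOneBodyKinematicRows` §5 and `HubbardTTPrimeCapCutDualRows`). Written for the certified fast
layer of the Hubbard re-charter (crew hubbard-fast, planner-p2 TARGET §2.2 (iv) / S4′: the **N2′
thermal-cap row** under the *torus-limit thermal convention* — "take the equilibrium state at
`(T, n)` to be a torus limit of the CANONICAL GIBBS STATES `ρ_{L,β} = e^{-βH_L}/Z` on the
`rectN n L`-particle, `S^z = 0` sector of the `L × L` torus"; the cap `e(ω_th) ≤ e₀(n) + T·s` was the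
one link of that row still carried at print level).

§1 (any Hermitian matrix `A` on a finite index type, any coordinate sector `p` with no matrix entries
between `p` and its complement): the compression `A|_p = A.submatrix val val` is Hermitian; its
Mathlib eigenbasis, extended by zero, is an orthonormal family of eigenvectors of `A` supported in the
sector (`sectorEigenvector`, `sectorEigenvalue`, `star_sectorEigenvector_dotProduct`,
`mulVec_sectorEigenvector`); with the canonical weights `w_a = e^{-βE_a}/Z` (`canonicalWeight`) the
finite-volume **energy–entropy cap** holds:
`Σ_a w_a ⟨ψ_a, Aψ_a⟩ ≤ A.minEnergyOn K + log(#p)/β` (`sum_canonicalWeight_mul_re_rayleigh_le`; Gibbs'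
variational principle `⟨H⟩ − S/β = −log Z/β ≤ E₀`, `S ≤ log dim`, through the tree's
`Matrix.sum_boltzmann_mul_le`, plus `groundEnergy_submatrix_le_minEnergyOn`).
§2 instantiates this for `H_L = hubbardTorusTT' L t t' U` and the sector `(rectN n L, S^z = 0)`
(configurations `szConfig n L`, `N↑ = N↓ = ⌊nL²/2⌋`; the Hamiltonian conserves `N↑, N↓`,
`LiebTwoHoppings.preservesSectors_hamiltonian₂`): the data `sectorGibbsCount n L`,
`sectorGibbsWeightTT' β t t' U n L`, `sectorGibbsVectorTT' t t' U n L` of the canonical Gibbs state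
as a MIXTURE in the format of `InfVolFermionState.IsTorusLimitOfMixture`, with every hypothesis of the
landed mixture rows discharged (weights `≥ 0` summing to `1`, unit `rectN n L`-particle components in
`szSector (rectN n L) 0`, eigenvectors), the finite cap
`Σ_i p_{L,i} E_{L,i} ≤ E₀(L; rectN n L) + log(#sector)/β` (`sum_sectorGibbsWeightTT'_mul_re_expect_le`,
sector energy = `rectN n L`-particle ground energy by `groundEnergy_hubbardTorusTT'_eq_minEnergyOn_szSector`)
and `#sector ≤ 4^{L²}` (`sectorGibbsCount_le`, `log_sectorGibbsCount_le`).
§3 passes to the thermodynamic limit: for every torus limit `ω` of these Gibbs mixtures along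
`Ls → ∞` (`β > 0`, `U ≥ 0`, `0 ≤ n < 2`),

  `e_{Φ(t,t',U)}(ω) ≤ e(t,t',U,n) + s/β` whenever `log #sector_L ≤ s·L²` eventually
  (`IsTorusLimitOfMixture.meanEnergy_hubbardTTPrime_le_energyDensityTT'_add_of_sectorGibbs`), in particular
  `e_{Φ(t,t',U)}(ω) ≤ e(t,t',U,n) + (log 4)/β` (`…_add_log_four_div`),

and records the CUT rows by name for these states (`…energyDensityTT'_le_meanEnergy_of_sectorGibbs`,
`…_add_slopes_of_sectorGibbs`), hence the two-sided window
`e(t,t',U,n) ≤ e_{Φ(t,t',U)}(ω) ≤ e(t,t',U,n) + (log 4)/β` (`…meanEnergy_hubbardTTPrime_mem_Icc_of_sectorGibbs`).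
§4 records, by name for the same states and with no temperature hypothesis, the kinematic rows of
`HubbardOneBodyKinematicRows` §5: `ω.density = n` (`…density_eq_of_sectorGibbs`),
`|K₁(ω)|, |K₂(ω)| ≤ 16/π² ≤ 1.6211390` (`…abs_meanEnergy_nnHop_le[_decimal]_of_sectorGibbs`,
`…abs_meanEnergy_diagHop_le[_decimal]_of_sectorGibbs`) and `max(0, n−1) ≤ D(ω) ≤ n/2`
(`…max_zero_density_sub_one_le_docc_of_sectorGibbs`, `…docc_le_half_density_of_sectorGibbs`,
`…docc_mem_Icc_of_sectorGibbs`, `…re_expect_docc_mem_Icc_of_sectorGibbs`).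
§5 adds the sharper density-dependent entropy constant: `log C(m,k) ≤ m·H_b(k/m)`
(`log_choose_le_mul_binEntropy`), `#sector ≤ C(L²,k)²` (`sectorGibbsCount_le_choose_sq`), hence
`log #sector ≤ 2L²·H_b(k/L²)` and, by continuity of `H_b` = Mathlib's `Real.binEntropy`,
`e_{Φ(t,t',U)}(ω) ≤ e(t,t',U,n) + 2·H_b(n/2)/β` (`…_add_binEntropy_div`; `2H_b(n/2)` is planner-p2's
`s_max(n)`, e.g. `2H_b(7/16) = 1.3706…`, `2H_b(1/2) = log 4`).
§6 supplies the outward decimal at the headline density `n = 7/8`: `2·H_b(7/16) < 1371/1000`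
(private `two_mul_binEntropy_seven_div_sixteen_lt`, from Mathlib's `Real.log_two_lt_d9`,
`Real.log_three_gt_d9` and `log 7 ≥ 2 log 2 + (log 3)/2 + 1/98`), hence the cap row
`e_{Φ(t,t',U)}(ω) ≤ e(t,t',U,7/8) + 1.371/β` (`…_add_decimal_div_of_seven_div_eight`) and the window
`…mem_Icc_decimal_of_seven_div_eight`. The identification of the mixture with the
trace form `tr(P_K e^{-βH} ·)/tr(P_K e^{-βH})` of `FinDimSpectrumSectorGibbsLimit` is not needed here
and not included. Everything is PROVED; the definitions are concrete (no `sorry`, no named fact).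

## Mathlib / tree search

REUSED: Mathlib `Matrix.IsHermitian.submatrix`, `Matrix.IsHermitian.eigenvectorUnitary(_apply)`,
`Matrix.IsHermitian.mulVec_eigenvectorBasis`, `Matrix.mem_unitaryGroup_iff'`, `exists_eq_ciInf_of_finite`,
`Fintype.card_subtype_le`, `Fintype.card_finset`; tree `Matrix.sum_boltzmann_mul_le` and
`Matrix.groundEnergy_eq_iInf_eigenvalues_holds`, `Matrix.groundEnergy_le_rayleigh_holds`
(`DuhamelTwoPoint` / `FinDimSpectrum(Proofs)`), `Matrix.minEnergyOn`, `szSector`,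
`mem_szSector_two_mul_zero_iff`, `IsInSector(.isNParticle)`, `pairSet`, `upPart_pairSet`,
`downPart_pairSet`, `PreservesSectors`, `LiebTwoHoppings.preservesSectors_hamiltonian₂`,
`groundEnergy_hubbardTorusTT'_eq_minEnergyOn_szSector`, `card_orb`, `ThermodynamicLimit.rectN_le_two_mul`,
`tendsto_energyDensityTT'_torus`, `InfVolFermionState.IsTorusLimitOfMixture` with
`.tendsto_meanEnergy_hubbardTTPrime`, `.energyDensityTT'_le_meanEnergy_hubbardTTPrime`,
`.energyDensityTT'_le_meanEnergy_add_slopes`; for §4 the mixture rows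
`IsTorusLimitOfMixture.density_eq_of_rectN`, `.abs_meanEnergy_nnHop_le(_decimal)`,
`.abs_meanEnergy_diagHop_le(_decimal)`, `.docc_nonneg`, `.docc_le_half_density`, `.density_sub_one_le_docc`,
`.meanEnergy_onSite_eq_re_expect_docc` (`HubbardOneBodyKinematicRows` §5, `TorusLimitOfMixtures`); for §5 `Literature.Analysis.SpecialFunctions.log_choose_le_entropy`
(`LogChooseStirling`), Mathlib `Real.binEntropy(_continuous)` (§6: `Real.log_two_lt_d9`, `Real.log_three_gt_d9`,
`Real.one_sub_inv_le_log_of_pos`; `lean search 'log_seven|Real.log 7'`: only `log 7 ≤ 2`-type bounds in the tree), `Fintype.card_finset_len`, `pairSet_upPart_downPart`,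
`ThermodynamicLimit.tendsto_rectN_div_sq` (near-duplicate noted by the gate: the Summits-side support file
`ThermalWedgeTwSeededEnsembleEquivalenceRSharpSectorEntropy` rewrites the same Literature lemma in entropy form
for its own sector count; Literature cannot import it, hence the 25-line Literature-side copy here).
The extension-by-zero bookkeeping of §1 follows the proof
of `sector_groundState` (`SectorSpectrum`), whose `have`s are not exported.
`lean search 'sectorEigenvector|canonicalWeight|sectorGibbs|TorusSectorGibbs' --decl`: nothing
(`boltzmannWeight` exists only for the classical oscillator chain of `KineticTheory`, a different object).

## References

* R. B. Israel, *Convexity in the Theory of Lattice Gases* (1979), Lemma II.3.1 (finite-volume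
  variational principle `S_Λ(ρ) − ρ(H_Λ) ≤ log Z_Λ`, equality iff `ρ` is the Gibbs state; read on
  the materialised pages, book pp. 46–47) and §I.3 eq. (26) (Gibbs states with periodic boundary
  conditions). [cite: Israel1979, Lemma II.3.1]
* D. Ruelle, *Statistical Mechanics: Rigorous Results* (1969), §3.4 (ground-state energy density as an
  infimum over states). [cite: Ruelle1969, §3.4]
* O. Bratteli, A. Kishimoto, D. W. Robinson, Commun. Math. Phys. 64 (1978) 41, Thm. 2.
  [cite: BratteliKishimotoRobinson1978, Thm. 2]
* H. Tasaki, *Physics and Mathematics of Quantum Many-Body Systems* (2020), §2.2 (spectral theory in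
  symmetry sectors), App. A. [cite: Tasaki2020, §2.2]
* E. H. Lieb, Phys. Rev. Lett. 62 (1989) 1201, proof of Theorem 1 and Remark (2) (working in the
  `S^z = 0` sector; `H` conserves `N↑, N↓`). [cite: LiebPRL1989, proof of Theorem 1]
* T. Koma, H. Tasaki, J. Stat. Phys. 76 (1994) 745, §1. [cite: KomaTasaki1994, §1]
* E. H. Lieb, M. Loss, *Fluxes, Laplacians, and Kasteleyn's theorem*, Duke Math. J. 71 (1993) 337,
  §8, Theorem 8.2 (the half-filled free band minimises the hopping energy). [cite: LiebLoss1993, §8, Theorem 8.2]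
-/

noncomputable section

namespace Literature.MathematicalPhysics.QuantumLattice

open Matrix Finset HubbardWave0 Literature.Probability.LatticeModels ThermodynamicLimit
open _root_.Filter
open scoped _root_.Topology ComplexOrder BigOperators

/-! ### §1 Eigen-mixtures of a Hermitian matrix compressed to an invariant coordinate sector -/

section CoordinateSector

variable {ι : Type*} [Fintype ι] [DecidableEq ι]

/-- Extension by zero of a function on the coordinates in `p` to all coordinates. [folklore] -/
def sectorExtend (p : ι → Prop) [DecidablePred p] (φ : Subtype p → ℂ) : ι → ℂ :=
  fun i => if h : p i then φ ⟨i, h⟩ else 0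

variable (p : ι → Prop) [DecidablePred p]

omit [Fintype ι] [DecidableEq ι] in
/-- `sectorExtend` on a coordinate of the sector. [folklore] -/
@[simp] private theorem sectorExtend_apply_val (φ : Subtype p → ℂ) (a : Subtype p) :
    sectorExtend p φ a.1 = φ a := by
  simp [sectorExtend, a.2]

omit [Fintype ι] [DecidableEq ι] in
/-- `sectorExtend` vanishes off the sector. [folklore] -/
private theorem sectorExtend_apply_of_not {i : ι} (hi : ¬ p i) (φ : Subtype p → ℂ) :
    sectorExtend p φ i = 0 := by
  simp [sectorExtend, hi]

omit [Fintype ι] [DecidableEq ι] in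
/-- A vector supported in the sector is the extension of its restriction. [folklore] -/
private theorem sectorExtend_restrict {v : ι → ℂ} (hv : ∀ i, ¬ p i → v i = 0) :
    sectorExtend p (fun a : Subtype p => v a.1) = v := by
  funext i
  by_cases hi : p i
  · exact sectorExtend_apply_val p (fun a : Subtype p => v a.1) ⟨i, hi⟩
  · rw [sectorExtend_apply_of_not p hi, hv i hi]

omit [Fintype ι] [DecidableEq ι] in
/-- `sectorExtend` commutes with scalars. [folklore] -/
private theorem sectorExtend_smul (c : ℂ) (φ : Subtype p → ℂ) :
    sectorExtend p (c • φ) = c • sectorExtend p φ := by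
  funext i
  by_cases hi : p i <;> simp [sectorExtend, hi]

omit [DecidableEq ι] in
/-- A sum of a function vanishing off `p` is the sum over `Subtype p`. [folklore] -/
private theorem sum_eq_sum_subtype_of_vanish (f : ι → ℂ) (hf : ∀ i, ¬ p i → f i = 0) :
    ∑ i, f i = ∑ a : Subtype p, f a.1 := by
  rw [← Finset.sum_subtype (Finset.univ.filter p) (by simp), Finset.sum_filter_of_ne]
  intro i _ hi
  by_contra h
  exact hi (hf i h)

omit [DecidableEq ι] in
/-- Inner products against an extended vector only see the sector coordinates:
`⟨ext φ, w⟩ = ⟨φ, w|_p⟩`. [folklore] -/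
private theorem star_sectorExtend_dotProduct (φ : Subtype p → ℂ) (w : ι → ℂ) :
    star (sectorExtend p φ) ⬝ᵥ w = star φ ⬝ᵥ fun a : Subtype p => w a.1 := by
  rw [dotProduct, dotProduct, sum_eq_sum_subtype_of_vanish p]
  · refine Finset.sum_congr rfl fun a _ => ?_
    rw [Pi.star_apply, Pi.star_apply, sectorExtend_apply_val]
  · intro j hj
    rw [Pi.star_apply, sectorExtend_apply_of_not p hj, star_zero, zero_mul]

omit [DecidableEq ι] in
/-- **A matrix with no entries from the sector to its complement acts on extended vectors as
its compression**: `A (ext φ) = ext (A|_p φ)`, `A|_p = A.submatrix val val`. [folklore] -/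
private theorem mulVec_sectorExtend {A : Matrix ι ι ℂ} (hinv : ∀ i j, ¬ p i → p j → A i j = 0)
    (φ : Subtype p → ℂ) :
    A *ᵥ sectorExtend p φ =
      sectorExtend p (A.submatrix (Subtype.val : Subtype p → ι) Subtype.val *ᵥ φ) := by
  funext i
  rw [mulVec, dotProduct]
  by_cases hi : p i
  · have h1 : sectorExtend p (A.submatrix (Subtype.val : Subtype p → ι) Subtype.val *ᵥ φ) i =
        (A.submatrix (Subtype.val : Subtype p → ι) Subtype.val *ᵥ φ) ⟨i, hi⟩ :=
      sectorExtend_apply_val p _ ⟨i, hi⟩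
    rw [h1, mulVec, dotProduct, sum_eq_sum_subtype_of_vanish p]
    · refine Finset.sum_congr rfl fun a _ => ?_
      rw [sectorExtend_apply_val]; rfl
    · intro j hj; rw [sectorExtend_apply_of_not p hj, mul_zero]
  · rw [sectorExtend_apply_of_not p hi]
    refine Finset.sum_eq_zero fun j _ => ?_
    by_cases hj : p j
    · rw [hinv i j hi hj, zero_mul]
    · rw [sectorExtend_apply_of_not p hj, mul_zero]

/-- The `a`-th **eigenvalue of the compression** `A|_p` of a Hermitian matrix `A` to the coordinate
sector `p` (Mathlib's `Matrix.IsHermitian.eigenvalues` of `A.submatrix val val`).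
[cite: Tasaki2020, §2.2] -/
def sectorEigenvalue (A : Matrix ι ι ℂ) (hA : A.IsHermitian) (a : Subtype p) : ℝ :=
  (hA.submatrix (Subtype.val : Subtype p → ι)).eigenvalues a

/-- The `a`-th **eigenvector of the compression** `A|_p`, extended by zero to a vector of the whole
space supported in the sector (column `a` of Mathlib's `eigenvectorUnitary` of `A.submatrix val val`).
[cite: Tasaki2020, §2.2] -/
def sectorEigenvector (A : Matrix ι ι ℂ) (hA : A.IsHermitian) (a : Subtype p) : ι → ℂ :=
  sectorExtend p fun b =>
    ((hA.submatrix (Subtype.val : Subtype p → ι)).eigenvectorUnitary :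
      Matrix (Subtype p) (Subtype p) ℂ) b a

/-- The **canonical (Boltzmann) weights** `e^{-β E_a} / Σ_b e^{-β E_b}` of a finite family of
energies. [cite: Israel1979, Lemma II.3.1] -/
def canonicalWeight {κ : Type*} [Fintype κ] (β : ℝ) (E : κ → ℝ) (a : κ) : ℝ :=
  (∑ b, Real.exp (-(β * E b)))⁻¹ * Real.exp (-(β * E a))

/-- The sector eigenvectors vanish off the sector. [folklore] -/
private theorem sectorEigenvector_apply_of_not (A : Matrix ι ι ℂ) (hA : A.IsHermitian) (a : Subtype p)
    {i : ι} (hi : ¬ p i) : sectorEigenvector p A hA a i = 0 :=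
  sectorExtend_apply_of_not p hi _

/-- **Orthonormality of the sector eigenvectors**: `⟨ψ_a, ψ_b⟩ = δ_{ab}`. [cite: Tasaki2020, §2.2] -/
theorem star_sectorEigenvector_dotProduct (A : Matrix ι ι ℂ) (hA : A.IsHermitian)
    (a b : Subtype p) :
    star (sectorEigenvector p A hA a) ⬝ᵥ sectorEigenvector p A hA b = if a = b then 1 else 0 := by
  set hB := hA.submatrix (Subtype.val : Subtype p → ι) with hBdef
  set V : Matrix (Subtype p) (Subtype p) ℂ :=
    (hB.eigenvectorUnitary : Matrix (Subtype p) (Subtype p) ℂ) with hV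
  have hVV : star V * V = 1 := Matrix.mem_unitaryGroup_iff'.1 hB.eigenvectorUnitary.2
  rw [sectorEigenvector, star_sectorExtend_dotProduct]
  have h := congrFun (congrFun hVV a) b
  simp only [Matrix.mul_apply, Matrix.star_apply, Matrix.one_apply] at h
  rw [dotProduct, ← h]
  refine Finset.sum_congr rfl fun c _ => ?_
  rw [Pi.star_apply, sectorEigenvector, sectorExtend_apply_val]

/-- The sector eigenvectors are unit vectors. [cite: Tasaki2020, §2.2] -/
theorem star_sectorEigenvector_dotProduct_self (A : Matrix ι ι ℂ) (hA : A.IsHermitian)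
    (a : Subtype p) :
    star (sectorEigenvector p A hA a) ⬝ᵥ sectorEigenvector p A hA a = 1 := by
  rw [star_sectorEigenvector_dotProduct, if_pos rfl]

/-- **Eigenvalue equation**: if `A` has no entries between the sector and its complement, the
extended compression eigenvectors are eigenvectors of `A`: `A ψ_a = E_a ψ_a`.
[cite: Tasaki2020, §2.2] -/
theorem mulVec_sectorEigenvector {A : Matrix ι ι ℂ} (hA : A.IsHermitian)
    (hinv : ∀ i j, ¬ p i → p j → A i j = 0) (a : Subtype p) :
    A *ᵥ sectorEigenvector p A hA a = ((sectorEigenvalue p A hA a : ℝ) : ℂ) • sectorEigenvector p A hA a := by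
  set hB := hA.submatrix (Subtype.val : Subtype p → ι) with hBdef
  have hcol : (fun b : Subtype p => ((hB.eigenvectorUnitary : Matrix (Subtype p) (Subtype p) ℂ) b a)) =
      ⇑(hB.eigenvectorBasis a) := by
    funext b
    rw [Matrix.IsHermitian.eigenvectorUnitary_apply]
  rw [sectorEigenvector, mulVec_sectorExtend p hinv, hcol, hB.mulVec_eigenvectorBasis a,
    ← sectorExtend_smul]
  rfl

/-- The Rayleigh quotient of a sector eigenvector is its eigenvalue. [cite: Tasaki2020, §2.2] -/
theorem re_rayleigh_sectorEigenvector {A : Matrix ι ι ℂ} (hA : A.IsHermitian)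
    (hinv : ∀ i j, ¬ p i → p j → A i j = 0) (a : Subtype p) :
    (star (sectorEigenvector p A hA a) ⬝ᵥ (A *ᵥ sectorEigenvector p A hA a)).re =
      sectorEigenvalue p A hA a := by
  rw [mulVec_sectorEigenvector p hA hinv a, dotProduct_smul, star_sectorEigenvector_dotProduct_self,
    smul_eq_mul, mul_one, Complex.ofReal_re]

/-- Canonical weights are nonnegative. [cite: Israel1979, Lemma II.3.1] -/
theorem canonicalWeight_nonneg {κ : Type*} [Fintype κ] (β : ℝ) (E : κ → ℝ) (a : κ) :
    0 ≤ canonicalWeight β E a :=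
  mul_nonneg (inv_nonneg.2 (Finset.sum_nonneg fun _ _ => (Real.exp_pos _).le)) (Real.exp_pos _).le

/-- Canonical weights sum to one (nonempty family). [cite: Israel1979, Lemma II.3.1] -/
theorem sum_canonicalWeight {κ : Type*} [Fintype κ] [Nonempty κ] (β : ℝ) (E : κ → ℝ) :
    ∑ a, canonicalWeight β E a = 1 := by
  unfold canonicalWeight
  rw [← Finset.mul_sum]
  exact inv_mul_cancel₀ (Finset.sum_pos (fun _ _ => Real.exp_pos _) Finset.univ_nonempty).ne'

/-- Canonical weights are invariant under reindexing the family. [folklore] -/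
private theorem canonicalWeight_comp_equiv {κ κ' : Type*} [Fintype κ] [Fintype κ'] (e : κ' ≃ κ) (β : ℝ)
    (E : κ → ℝ) (a : κ') :
    canonicalWeight β (E ∘ e) a = canonicalWeight β E (e a) := by
  unfold canonicalWeight
  rw [show (∑ b, Real.exp (-(β * (E ∘ e) b))) = ∑ b, Real.exp (-(β * E b)) from
    Equiv.sum_comp e (fun b => Real.exp (-(β * E b)))]
  rfl

/-- **The ground energy of the compression is below the sector energy** `A.minEnergyOn K` of the
coordinate subspace `K = {v | v = 0 off p}` (in fact they are equal; only this half is used): every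
unit vector of `K` is an extended sector vector with the same Rayleigh quotient for `A|_p`
(`Matrix.groundEnergy_le_rayleigh`). [cite: Tasaki2020, §2.2] -/
theorem groundEnergy_submatrix_le_minEnergyOn {A : Matrix ι ι ℂ} (hA : A.IsHermitian)
    (hinv : ∀ i j, ¬ p i → p j → A i j = 0) (hp : ∃ i, p i)
    (K : Submodule ℂ (ι → ℂ)) (hK : ∀ v, v ∈ K ↔ ∀ i, ¬ p i → v i = 0) :
    (A.submatrix (Subtype.val : Subtype p → ι) Subtype.val).groundEnergy ≤ A.minEnergyOn K := by
  obtain ⟨i₀, hi₀⟩ := hp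
  set hB := hA.submatrix (Subtype.val : Subtype p → ι) with hBdef
  have hmemK : ∀ φ : Subtype p → ℂ, sectorExtend p φ ∈ K :=
    fun φ => (hK _).2 fun i hi => sectorExtend_apply_of_not p hi φ
  rw [Matrix.minEnergyOn]
  refine le_csInf ?_ ?_
  · refine ⟨_, sectorEigenvector p A hA ⟨i₀, hi₀⟩, hmemK _,
      star_sectorEigenvector_dotProduct_self p A hA _, rfl⟩
  · rintro E ⟨ψ, hψK, hψ1, rfl⟩
    have hψ0 : ∀ i, ¬ p i → ψ i = 0 := (hK ψ).1 hψK
    set φ : Subtype p → ℂ := fun a => ψ a.1 with hφ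
    have hψ : ψ = sectorExtend p φ := (sectorExtend_restrict p hψ0).symm
    have hφ1 : star φ ⬝ᵥ φ = 1 := by
      rw [hψ, star_sectorExtend_dotProduct] at hψ1
      simpa only [sectorExtend_apply_val] using hψ1
    have hray : (star ψ ⬝ᵥ A *ᵥ ψ).re =
        (star φ ⬝ᵥ (A.submatrix (Subtype.val : Subtype p → ι) Subtype.val *ᵥ φ)).re := by
      rw [hψ, mulVec_sectorExtend p hinv, star_sectorExtend_dotProduct]
      congr 2
      funext a
      exact sectorExtend_apply_val p _ a
    rw [hray]
    exact Matrix.groundEnergy_le_rayleigh_holds hB φ hφ1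

/-- **Energy–entropy cap of the canonical eigen-mixture in a sector** (Gibbs' variational
principle in finite volume, `⟨H⟩ − S/β = F ≤ E₀`, `S ≤ log dim`): for `β > 0`,
`Σ_a w_a ⟨ψ_a, A ψ_a⟩ ≤ A.minEnergyOn K + log (dim K)/β`, `w_a = e^{-βE_a}/Z` the canonical weights
of the compression eigenvalues, `dim K = #p`. [cite: Israel1979, Lemma II.3.1] -/
theorem sum_canonicalWeight_mul_re_rayleigh_le {A : Matrix ι ι ℂ} (hA : A.IsHermitian)
    (hinv : ∀ i j, ¬ p i → p j → A i j = 0) (hp : ∃ i, p i)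
    (K : Submodule ℂ (ι → ℂ)) (hK : ∀ v, v ∈ K ↔ ∀ i, ¬ p i → v i = 0) {β : ℝ} (hβ : 0 < β) :
    ∑ a, canonicalWeight β (sectorEigenvalue p A hA) a *
        (star (sectorEigenvector p A hA a) ⬝ᵥ (A *ᵥ sectorEigenvector p A hA a)).re ≤
      A.minEnergyOn K + Real.log (Fintype.card (Subtype p)) / β := by
  obtain ⟨i₀, hi₀⟩ := hp
  haveI : Nonempty (Subtype p) := ⟨⟨i₀, hi₀⟩⟩
  set hB := hA.submatrix (Subtype.val : Subtype p → ι) with hBdef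
  set E : Subtype p → ℝ := sectorEigenvalue p A hA with hE
  -- the compression's ground energy is an eigenvalue `E a₀`
  obtain ⟨a₀, ha₀⟩ : ∃ a₀, E a₀ = ⨅ a, E a := exists_eq_ciInf_of_finite
  have hground : (A.submatrix (Subtype.val : Subtype p → ι) Subtype.val).groundEnergy = E a₀ := by
    rw [ha₀, Matrix.groundEnergy_eq_iInf_eigenvalues_holds hB]
    rfl
  have hsum : ∑ a, canonicalWeight β E a *
      (star (sectorEigenvector p A hA a) ⬝ᵥ (A *ᵥ sectorEigenvector p A hA a)).re =
      (∑ b, Real.exp (-(β * E b)))⁻¹ * ∑ a, Real.exp (-(β * E a)) * E a := by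
    rw [Finset.mul_sum]
    refine Finset.sum_congr rfl fun a _ => ?_
    rw [re_rayleigh_sectorEigenvector p hA hinv a, canonicalWeight, mul_assoc]
  rw [hsum]
  calc (∑ b, Real.exp (-(β * E b)))⁻¹ * ∑ a, Real.exp (-(β * E a)) * E a
      ≤ E a₀ + Real.log (Fintype.card (Subtype p)) / β := Matrix.sum_boltzmann_mul_le hβ E a₀
    _ ≤ A.minEnergyOn K + Real.log (Fintype.card (Subtype p)) / β := by
        rw [← hground]
        linarith [groundEnergy_submatrix_le_minEnergyOn p hA hinv ⟨i₀, hi₀⟩ K hK]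

end CoordinateSector

/-! ### §2 The canonical Gibbs state of the `t–t'` torus on the sector `(rectN n L, S^z = 0)` -/

section TorusGibbs

/-- Half the sector particle number: `k_L(n) = ⌊n L²/2⌋`, so that `rectN n L = 2 k_L(n)` and the
`S^z = 0` sector is `(N↑, N↓) = (k, k)`. [folklore] -/
def halfRectN (n : ℝ) (L : ℕ) : ℕ := ⌊n * (L : ℝ) ^ 2 / 2⌋₊

/-- `rectN n L = 2 · halfRectN n L` (definitional). [folklore] -/
private theorem rectN_eq_two_mul_halfRectN (n : ℝ) (L : ℕ) : rectN n L = 2 * halfRectN n L := rfl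

/-- `halfRectN n L ≤ L² = #sites` for `0 ≤ n ≤ 2`. [folklore] -/
private theorem halfRectN_le_card {n : ℝ} (hn0 : 0 ≤ n) (hn2 : n ≤ 2) (L : ℕ) :
    halfRectN n L ≤ Fintype.card (FermionTorus 2 L) := by
  have h := ThermodynamicLimit.rectN_le_two_mul hn0 hn2 L
  rw [rectN_eq_two_mul_halfRectN] at h
  have hcard : Fintype.card (FermionTorus 2 L) = L * L := by simp [FermionTorus, sq]
  rw [hcard]
  exact Nat.le_of_mul_le_mul_left h two_pos

/-- The occupation configurations of the sector `(N↑, N↓) = (k_L(n), k_L(n))`, i.e.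
`(N, S^z) = (rectN n L, 0)`. [cite: LiebPRL1989, proof of Theorem 1] -/
def szConfig (n : ℝ) (L : ℕ) (s : Finset (Orb (FermionTorus 2 L))) : Prop :=
  (upPart s).card = halfRectN n L ∧ (downPart s).card = halfRectN n L

/-- Membership in the sector is decidable (two cardinality equations). [folklore] -/
instance instDecidablePredSzConfig (n : ℝ) (L : ℕ) : DecidablePred (szConfig n L) :=
  fun _ => instDecidableAnd

/-- The sector `(rectN n L, 0)` is nonempty for `0 ≤ n ≤ 2` (Lieb's proof works in this
sector). [cite: LiebPRL1989, proof of Theorem 1] -/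
theorem exists_szConfig {n : ℝ} (hn0 : 0 ≤ n) (hn2 : n ≤ 2) (L : ℕ) : ∃ s, szConfig n L s := by
  classical
  obtain ⟨α₀, -, hα₀⟩ : ∃ α₀ : Finset (FermionTorus 2 L), α₀ ⊆ univ ∧ α₀.card = halfRectN n L :=
    Finset.exists_subset_card_eq (by rw [Finset.card_univ]; exact halfRectN_le_card hn0 hn2 L)
  refine ⟨pairSet α₀ α₀, ?_, ?_⟩
  · rw [upPart_pairSet, hα₀]
  · rw [downPart_pairSet, hα₀]

/-- Membership in `szSector (rectN n L) 0` is support in `szConfig n L`.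
[cite: LiebPRL1989, proof of Theorem 1] -/
theorem mem_szSector_rectN_iff (n : ℝ) (L : ℕ) (v : Fock (Orb (FermionTorus 2 L))) :
    v ∈ szSector (rectN n L) (0 : ℝ) ↔ ∀ s, ¬ szConfig n L s → v s = 0 := by
  rw [rectN_eq_two_mul_halfRectN, mem_szSector_two_mul_zero_iff]
  rfl

/-- The `t–t'` torus Hamiltonian has no entries between the sector and its complement (it conserves
`N↑` and `N↓`). [cite: LiebPRL1989, Remark (2)] -/
theorem hubbardTorusTT'_apply_eq_zero_of_szConfig (L : ℕ) (t t' U n : ℝ)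
    (s s' : Finset (Orb (FermionTorus 2 L))) (hs : ¬ szConfig n L s) (hs' : szConfig n L s') :
    hubbardTorusTT' L t t' U s s' = 0 := by
  have hHs : PreservesSectors (hubbardTorusTT' L t t' U) :=
    LiebTwoHoppings.preservesSectors_hamiltonian₂ (fermionTorusGraph 2 L) (fermionTorusDiagGraph L) t t' U
  by_contra h
  have := hHs s s' h
  exact hs ⟨this.1.trans hs'.1, this.2.trans hs'.2⟩

/-- The number of configurations in the sector (= the dimension of the sector = the number of
components of the canonical Gibbs mixture). [cite: Israel1979, Lemma II.3.1] -/
def sectorGibbsCount (n : ℝ) (L : ℕ) : ℕ := Fintype.card (Subtype (szConfig n L))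

/-- Enumeration of the sector configurations by `Fin (sectorGibbsCount n L)`. [folklore] -/
def sectorGibbsIndex (n : ℝ) (L : ℕ) : Fin (sectorGibbsCount n L) ≃ Subtype (szConfig n L) :=
  (Fintype.equivFin (Subtype (szConfig n L))).symm

/-- The energies of the canonical Gibbs mixture: the eigenvalues of `H_L(t,t',U)` restricted to
the sector `(rectN n L, S^z = 0)`. [cite: Tasaki2020, §2.2] -/
def sectorGibbsEnergyTT' (t t' U n : ℝ) (L : ℕ) (i : Fin (sectorGibbsCount n L)) : ℝ :=
  sectorEigenvalue (szConfig n L) (hubbardTorusTT' L t t' U) (hubbardTorusTT'_isHermitian L t t' U)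
    (sectorGibbsIndex n L i)

/-- The components of the canonical Gibbs mixture: an orthonormal eigenbasis of `H_L(t,t',U)` in
the sector `(rectN n L, S^z = 0)`. [cite: Tasaki2020, §2.2] -/
def sectorGibbsVectorTT' (t t' U n : ℝ) (L : ℕ) (i : Fin (sectorGibbsCount n L)) :
    Fock (Orb (FermionTorus 2 L)) :=
  sectorEigenvector (szConfig n L) (hubbardTorusTT' L t t' U) (hubbardTorusTT'_isHermitian L t t' U)
    (sectorGibbsIndex n L i)

/-- The weights of the **canonical Gibbs state** `ρ_{L,β} = e^{-βH_L}/Z` on the sector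
`(rectN n L, S^z = 0)` written as a mixture of its eigenbasis: `p_{L,i} = e^{-βE_{L,i}}/Σ_j e^{-βE_{L,j}}`.
[cite: Israel1979, §I.3 eq. (26)] -/
def sectorGibbsWeightTT' (β t t' U n : ℝ) (L : ℕ) (i : Fin (sectorGibbsCount n L)) : ℝ :=
  canonicalWeight β (sectorGibbsEnergyTT' t t' U n L) i

/-- The components lie in the sector `(N↑, N↓) = (k, k)`. [cite: LiebPRL1989, proof of Theorem 1] -/
theorem isInSector_sectorGibbsVectorTT' (t t' U n : ℝ) (L : ℕ) (i : Fin (sectorGibbsCount n L)) :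
    IsInSector (halfRectN n L) (halfRectN n L) (sectorGibbsVectorTT' t t' U n L i) :=
  fun _ hs => sectorEigenvector_apply_of_not (szConfig n L) _ _ _ hs

/-- The components lie in `szSector (rectN n L) 0`. [cite: LiebPRL1989, proof of Theorem 1] -/
theorem sectorGibbsVectorTT'_mem_szSector (t t' U n : ℝ) (L : ℕ) (i : Fin (sectorGibbsCount n L)) :
    sectorGibbsVectorTT' t t' U n L i ∈ szSector (rectN n L) (0 : ℝ) :=
  (mem_szSector_rectN_iff n L _).2 (isInSector_sectorGibbsVectorTT' t t' U n L i)

/-- The components are `rectN n L`-particle vectors. [cite: LiebPRL1989, proof of Theorem 1] -/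
theorem isNParticle_sectorGibbsVectorTT' (t t' U n : ℝ) (L : ℕ) (i : Fin (sectorGibbsCount n L)) :
    IsNParticle (rectN n L) (sectorGibbsVectorTT' t t' U n L i) := by
  have h := (isInSector_sectorGibbsVectorTT' t t' U n L i).isNParticle
  rwa [← two_mul] at h

/-- The components are unit vectors. [cite: Tasaki2020, §2.2] -/
theorem star_sectorGibbsVectorTT'_dotProduct_self (t t' U n : ℝ) (L : ℕ)
    (i : Fin (sectorGibbsCount n L)) :
    star (sectorGibbsVectorTT' t t' U n L i) ⬝ᵥ sectorGibbsVectorTT' t t' U n L i = 1 :=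
  star_sectorEigenvector_dotProduct_self (szConfig n L) _ _ _

/-- The components are orthonormal. [cite: Tasaki2020, §2.2] -/
theorem star_sectorGibbsVectorTT'_dotProduct (t t' U n : ℝ) (L : ℕ)
    (i j : Fin (sectorGibbsCount n L)) :
    star (sectorGibbsVectorTT' t t' U n L i) ⬝ᵥ sectorGibbsVectorTT' t t' U n L j =
      if i = j then 1 else 0 := by
  rw [sectorGibbsVectorTT', sectorGibbsVectorTT', star_sectorEigenvector_dotProduct]
  simp only [EmbeddingLike.apply_eq_iff_eq]

/-- The components are eigenvectors: `H_L ψ_{L,i} = E_{L,i} ψ_{L,i}`. [cite: Tasaki2020, §2.2] -/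
theorem hubbardTorusTT'_mulVec_sectorGibbsVectorTT' (t t' U n : ℝ) (L : ℕ)
    (i : Fin (sectorGibbsCount n L)) :
    hubbardTorusTT' L t t' U *ᵥ sectorGibbsVectorTT' t t' U n L i =
      ((sectorGibbsEnergyTT' t t' U n L i : ℝ) : ℂ) • sectorGibbsVectorTT' t t' U n L i :=
  mulVec_sectorEigenvector (szConfig n L) _
    (fun s s' hs hs' => hubbardTorusTT'_apply_eq_zero_of_szConfig L t t' U n s s' hs hs') _

/-- The mean energy of a component is its energy: `Re⟨ψ_{L,i}, H_L ψ_{L,i}⟩ = E_{L,i}`.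
[cite: Tasaki2020, §2.2] -/
theorem re_expect_sectorGibbsVectorTT' (t t' U n : ℝ) (L : ℕ) (i : Fin (sectorGibbsCount n L)) :
    (expect (hubbardTorusTT' L t t' U) (sectorGibbsVectorTT' t t' U n L i)).re =
      sectorGibbsEnergyTT' t t' U n L i :=
  re_rayleigh_sectorEigenvector (szConfig n L) _
    (fun s s' hs hs' => hubbardTorusTT'_apply_eq_zero_of_szConfig L t t' U n s s' hs hs') _

/-- The Gibbs weights are nonnegative. [cite: Israel1979, Lemma II.3.1] -/
theorem sectorGibbsWeightTT'_nonneg (β t t' U n : ℝ) (L : ℕ) (i : Fin (sectorGibbsCount n L)) :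
    0 ≤ sectorGibbsWeightTT' β t t' U n L i :=
  canonicalWeight_nonneg β _ i

/-- The Gibbs weights sum to one (`0 ≤ n ≤ 2`, so that the sector is nonempty).
[cite: Israel1979, Lemma II.3.1] -/
theorem sum_sectorGibbsWeightTT' (β t t' U : ℝ) {n : ℝ} (hn0 : 0 ≤ n) (hn2 : n ≤ 2) (L : ℕ) :
    ∑ i, sectorGibbsWeightTT' β t t' U n L i = 1 := by
  obtain ⟨s, hs⟩ := exists_szConfig hn0 hn2 L
  haveI : Nonempty (Fin (sectorGibbsCount n L)) := ⟨(sectorGibbsIndex n L).symm ⟨s, hs⟩⟩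
  exact sum_canonicalWeight β _

/-- **Finite-volume energy–entropy cap for the canonical sector Gibbs state**:
`tr(ρ_{L,β} H_L) = Σ_i p_{L,i} E_{L,i} ≤ E₀(L; rectN n L) + log(dim sector)/β` (`β > 0`, `0 ≤ n ≤ 2`,
`L ≥ 1`; the sector ground energy is the `rectN n L`-particle ground energy,
`groundEnergy_hubbardTorusTT'_eq_minEnergyOn_szSector`). [cite: Israel1979, Lemma II.3.1] -/
theorem sum_sectorGibbsWeightTT'_mul_re_expect_le (L : ℕ) [NeZero L] (t t' U : ℝ) {n : ℝ}
    (hn0 : 0 ≤ n) (hn2 : n ≤ 2) {β : ℝ} (hβ : 0 < β) :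
    ∑ i, sectorGibbsWeightTT' β t t' U n L i *
        (expect (hubbardTorusTT' L t t' U) (sectorGibbsVectorTT' t t' U n L i)).re ≤
      groundEnergy (hubbardTorusTT' L t t' U) (rectN n L) +
        Real.log (sectorGibbsCount n L) / β := by
  set H := hubbardTorusTT' L t t' U with hH
  have hA : H.IsHermitian := hubbardTorusTT'_isHermitian L t t' U
  have hinv : ∀ s s', ¬ szConfig n L s → szConfig n L s' → H s s' = 0 :=
    fun s s' hs hs' => hubbardTorusTT'_apply_eq_zero_of_szConfig L t t' U n s s' hs hs'
  have hp : ∃ s, szConfig n L s := exists_szConfig hn0 hn2 L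
  have hK : ∀ v : Fock (Orb (FermionTorus 2 L)), v ∈ szSector (rectN n L) (0 : ℝ) ↔
      ∀ s, ¬ szConfig n L s → v s = 0 := mem_szSector_rectN_iff n L
  have hcap := sum_canonicalWeight_mul_re_rayleigh_le (szConfig n L) hA hinv hp
    (szSector (rectN n L) 0) hK hβ
  have hGS : H.minEnergyOn (szSector (rectN n L) 0) = groundEnergy H (rectN n L) := by
    rw [rectN_eq_two_mul_halfRectN, hH,
      groundEnergy_hubbardTorusTT'_eq_minEnergyOn_szSector L t t' U (halfRectN_le_card hn0 hn2 L)]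
  rw [hGS] at hcap
  -- transport the sum from `Subtype (szConfig n L)` to `Fin (sectorGibbsCount n L)`
  set e := sectorGibbsIndex n L with he
  have hsum : ∑ i, sectorGibbsWeightTT' β t t' U n L i *
      (expect H (sectorGibbsVectorTT' t t' U n L i)).re =
      ∑ a, canonicalWeight β (sectorEigenvalue (szConfig n L) H hA) a *
        (star (sectorEigenvector (szConfig n L) H hA a) ⬝ᵥ
          (H *ᵥ sectorEigenvector (szConfig n L) H hA a)).re := by
    rw [← Equiv.sum_comp e]
    refine Finset.sum_congr rfl fun i _ => ?_
    rw [sectorGibbsWeightTT', show sectorGibbsEnergyTT' t t' U n L =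
      sectorEigenvalue (szConfig n L) H hA ∘ e from rfl, canonicalWeight_comp_equiv]
    rfl
  rw [hsum]
  exact hcap

/-- The sector has at most `4^{L²}` configurations (all subsets of the `2L²` orbitals): the
entropy bound `S ≤ log dim ≤ L² log 4`. [cite: Israel1979, Lemma II.3.1] -/
theorem sectorGibbsCount_le (n : ℝ) (L : ℕ) : sectorGibbsCount n L ≤ 4 ^ (L ^ 2) := by
  have h1 : sectorGibbsCount n L ≤ Fintype.card (Finset (Orb (FermionTorus 2 L))) :=
    Fintype.card_subtype_le _
  have h2 : Fintype.card (Finset (Orb (FermionTorus 2 L))) = 4 ^ (L ^ 2) := by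
    rw [Fintype.card_finset]
    have : Fintype.card (Orb (FermionTorus 2 L)) = 2 * L ^ 2 := by
      rw [card_orb]
      simp [FermionTorus, sq]
    rw [this, pow_mul]
    norm_num
  exact h1.trans h2.le

/-- `log #sector ≤ L² · log 4` (entropy density at most `log 4` per site).
[cite: Israel1979, Lemma II.3.1] -/
theorem log_sectorGibbsCount_le (n : ℝ) (L : ℕ) :
    Real.log (sectorGibbsCount n L) ≤ Real.log 4 * (L : ℝ) ^ 2 := by
  rcases Nat.eq_zero_or_pos (sectorGibbsCount n L) with h0 | hpos
  · rw [h0, Nat.cast_zero, Real.log_zero]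
    exact mul_nonneg (Real.log_nonneg (by norm_num)) (sq_nonneg _)
  · have hle : (sectorGibbsCount n L : ℝ) ≤ (4 : ℝ) ^ (L ^ 2) := by
      exact_mod_cast sectorGibbsCount_le n L
    calc Real.log (sectorGibbsCount n L) ≤ Real.log ((4 : ℝ) ^ (L ^ 2)) :=
          Real.log_le_log (by exact_mod_cast hpos) hle
      _ = Real.log 4 * (L : ℝ) ^ 2 := by rw [Real.log_pow]; push_cast; ring

end TorusGibbs

/-! ### §3 Thermodynamic limits of the canonical sector Gibbs states: the N2′ CAP row and the
CUT rows by name -/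

namespace InfVolFermionState

/-- **The energy–entropy CAP in the thermodynamic limit (general entropy bound).** Let `ω` be a
torus limit of the canonical Gibbs states `ρ_{Ls j, β}` on the sectors `(rectN n (Ls j), S^z = 0)` of
`H_{Ls j}(t,t',U)` (`β > 0`, `U ≥ 0`, `0 ≤ n < 2`, `Ls → ∞`), and suppose the sector dimensions obey
`log dim ≤ s · L²` eventually. Then the `t–t'` mean energy of `ω` is at most the ground-state energy
density plus `s/β`: `e_{Φ(t,t',U)}(ω) ≤ e(t,t',U,n) + s/β`. (Divide the finite-volume cap by `L²` and
pass to the limit: `IsTorusLimitOfMixture.tendsto_meanEnergy_hubbardTTPrime`,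
`tendsto_energyDensityTT'_torus`.) [cite: Israel1979, Lemma II.3.1] [cite: Ruelle1969, §3.4] -/
theorem IsTorusLimitOfMixture.meanEnergy_hubbardTTPrime_le_energyDensityTT'_add_of_sectorGibbs
    (t t' : ℝ) {U : ℝ} (hU : 0 ≤ U) {n : ℝ} (hn0 : 0 ≤ n) (hn2 : n < 2) {β : ℝ} (hβ : 0 < β)
    {ω : InfVolFermionState 2} {Ls : ℕ → ℕ}
    (h : ω.IsTorusLimitOfMixture (sectorGibbsCount n) (fun L => sectorGibbsWeightTT' β t t' U n L)
      (fun L => sectorGibbsVectorTT' t t' U n L) Ls)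
    (hLs : Tendsto Ls atTop atTop) {s : ℝ}
    (hs : ∀ᶠ j in atTop, Real.log (sectorGibbsCount n (Ls j)) ≤ s * (Ls j : ℝ) ^ 2) :
    ω.meanEnergy (hubbardTTPrimeFermionInteraction t t' U) 1 ≤ energyDensityTT' t t' U n + s / β := by
  have h1 := h.tendsto_meanEnergy_hubbardTTPrime t t' U hLs
  have h2 := ((tendsto_energyDensityTT'_torus t t' hU hn0 hn2).comp hLs).add_const (s / β)
  refine le_of_tendsto_of_tendsto h1 h2 ?_
  filter_upwards [hs, hLs.eventually_ge_atTop 1] with j hsj hj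
  haveI : NeZero (Ls j) := ⟨by omega⟩
  have hL2 : (0 : ℝ) < (Ls j : ℝ) ^ 2 := by positivity
  have hcap := sum_sectorGibbsWeightTT'_mul_re_expect_le (Ls j) t t' U hn0 hn2.le hβ
  simp only [Function.comp_apply]
  have hdiv : ∑ i, sectorGibbsWeightTT' β t t' U n (Ls j) i *
      ((QuantumLattice.expect (hubbardTorusTT' (Ls j) t t' U)
        (sectorGibbsVectorTT' t t' U n (Ls j) i)).re / (Ls j : ℝ) ^ 2) =
      (∑ i, sectorGibbsWeightTT' β t t' U n (Ls j) i *
        (QuantumLattice.expect (hubbardTorusTT' (Ls j) t t' U)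
          (sectorGibbsVectorTT' t t' U n (Ls j) i)).re) / (Ls j : ℝ) ^ 2 := by
    rw [Finset.sum_div]
    refine Finset.sum_congr rfl fun i _ => ?_
    ring
  rw [hdiv, div_le_iff₀ hL2]
  have hlog : Real.log (sectorGibbsCount n (Ls j)) / β ≤ s * (Ls j : ℝ) ^ 2 / β :=
    div_le_div_of_nonneg_right hsj hβ.le
  have hrhs : (groundEnergy (hubbardTorusTT' (Ls j) t t' U) (rectN n (Ls j)) / (Ls j : ℝ) ^ 2 + s / β) *
      (Ls j : ℝ) ^ 2 =
      groundEnergy (hubbardTorusTT' (Ls j) t t' U) (rectN n (Ls j)) + s * (Ls j : ℝ) ^ 2 / β := by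
    field_simp
  rw [hrhs]
  linarith

/-- **The N2′ CAP row** (torus-limit thermal convention of the Hubbard fast layer): for every torus
limit `ω` of the canonical sector Gibbs states at inverse temperature `β > 0` (`U ≥ 0`, `0 ≤ n < 2`,
`Ls → ∞`), `e_{Φ(t,t',U)}(ω) ≤ e(t,t',U,n) + (log 4)/β` — the entropy density of `2L²` fermionic
modes is at most `log 4` per site. [cite: Israel1979, Lemma II.3.1] [cite: Ruelle1969, §3.4] -/
theorem IsTorusLimitOfMixture.meanEnergy_hubbardTTPrime_le_energyDensityTT'_add_log_four_div
    (t t' : ℝ) {U : ℝ} (hU : 0 ≤ U) {n : ℝ} (hn0 : 0 ≤ n) (hn2 : n < 2) {β : ℝ} (hβ : 0 < β)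
    {ω : InfVolFermionState 2} {Ls : ℕ → ℕ}
    (h : ω.IsTorusLimitOfMixture (sectorGibbsCount n) (fun L => sectorGibbsWeightTT' β t t' U n L)
      (fun L => sectorGibbsVectorTT' t t' U n L) Ls)
    (hLs : Tendsto Ls atTop atTop) :
    ω.meanEnergy (hubbardTTPrimeFermionInteraction t t' U) 1 ≤
      energyDensityTT' t t' U n + Real.log 4 / β :=
  h.meanEnergy_hubbardTTPrime_le_energyDensityTT'_add_of_sectorGibbs t t' hU hn0 hn2 hβ hLs
    (Eventually.of_forall fun j => log_sectorGibbsCount_le n (Ls j))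

/-- **The CUT rows by name for torus limits of canonical sector Gibbs states**: the variational
inequality at EVERY coupling, `e(t,t'',U'',n) ≤ e_{Φ(t,t'',U'')}(ω)` for all `t''` and `U'' ≥ 0`
(`IsTorusLimitOfMixture.energyDensityTT'_le_meanEnergy_hubbardTTPrime` with its four hypotheses —
nonnegative weights summing to one, unit `rectN n L`-particle components — discharged by §2).
[cite: Ruelle1969, §3.4] [cite: BratteliKishimotoRobinson1978, Thm. 2] -/
theorem IsTorusLimitOfMixture.energyDensityTT'_le_meanEnergy_of_sectorGibbs
    (t t' U : ℝ) {n : ℝ} (hn0 : 0 ≤ n) (hn2 : n < 2) (β : ℝ)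
    {ω : InfVolFermionState 2} {Ls : ℕ → ℕ}
    (h : ω.IsTorusLimitOfMixture (sectorGibbsCount n) (fun L => sectorGibbsWeightTT' β t t' U n L)
      (fun L => sectorGibbsVectorTT' t t' U n L) Ls)
    (hLs : Tendsto Ls atTop atTop) (t'' : ℝ) {U'' : ℝ} (hU'' : 0 ≤ U'') :
    energyDensityTT' t t'' U'' n ≤ ω.meanEnergy (hubbardTTPrimeFermionInteraction t t'' U'') 1 :=
  h.energyDensityTT'_le_meanEnergy_hubbardTTPrime t t'' hU'' hn0 hn2 hLs
    (fun L i => sectorGibbsWeightTT'_nonneg β t t' U n L i)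
    (fun L => sum_sectorGibbsWeightTT' β t t' U hn0 hn2.le L)
    (fun L i => isNParticle_sectorGibbsVectorTT' t t' U n L i)
    (fun L i => star_sectorGibbsVectorTT'_dotProduct_self t t' U n L i)

/-- **The anchor cut row with slopes, by name** (`IsTorusLimitOfMixture.energyDensityTT'_le_meanEnergy_add_slopes`):
for every anchor `(t'₀, U₀)` and every `t''`, `U'' ≥ 0`,
`e(t,t'',U'',n) ≤ e_{Φ(t,t'₀,U₀)}(ω) + (U'' − U₀)·Re ω(n↑n↓) + (t'' − t'₀)·e_{Φ(0,1,0)}(ω)`.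
[cite: Ruelle1969, §3.4] [cite: KomaTasaki1994, §1] -/
theorem IsTorusLimitOfMixture.energyDensityTT'_le_meanEnergy_add_slopes_of_sectorGibbs
    (t t' U : ℝ) {n : ℝ} (hn0 : 0 ≤ n) (hn2 : n < 2) (β : ℝ)
    {ω : InfVolFermionState 2} {Ls : ℕ → ℕ}
    (h : ω.IsTorusLimitOfMixture (sectorGibbsCount n) (fun L => sectorGibbsWeightTT' β t t' U n L)
      (fun L => sectorGibbsVectorTT' t t' U n L) Ls)
    (hLs : Tendsto Ls atTop atTop) (t'₀ U₀ t'' : ℝ) {U'' : ℝ} (hU'' : 0 ≤ U'') :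
    energyDensityTT' t t'' U'' n ≤
      ω.meanEnergy (hubbardTTPrimeFermionInteraction t t'₀ U₀) 1 +
        (U'' - U₀) * (ω.expect ({0} : Finset (Site 2))
          (nAt 0 (Finset.mem_singleton_self 0) 0 * nAt 0 (Finset.mem_singleton_self 0) 1)).re +
          (t'' - t'₀) * ω.meanEnergy (hubbardTTPrimeFermionInteraction 0 1 0) 1 :=
  h.energyDensityTT'_le_meanEnergy_add_slopes t t'₀ U₀ hn0 hn2 hLs
    (fun L i => sectorGibbsWeightTT'_nonneg β t t' U n L i)
    (fun L => sum_sectorGibbsWeightTT' β t t' U hn0 hn2.le L)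
    (fun L i => isNParticle_sectorGibbsVectorTT' t t' U n L i)
    (fun L i => star_sectorGibbsVectorTT'_dotProduct_self t t' U n L i) t'' hU''

/-- **The two-sided energy window of a thermal torus limit**, combining the cap at its own coupling
with the cut: `e(t,t',U,n) ≤ e_{Φ(t,t',U)}(ω) ≤ e(t,t',U,n) + (log 4)/β`.
[cite: Israel1979, Lemma II.3.1] [cite: Ruelle1969, §3.4] -/
theorem IsTorusLimitOfMixture.meanEnergy_hubbardTTPrime_mem_Icc_of_sectorGibbs
    (t t' : ℝ) {U : ℝ} (hU : 0 ≤ U) {n : ℝ} (hn0 : 0 ≤ n) (hn2 : n < 2) {β : ℝ} (hβ : 0 < β)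
    {ω : InfVolFermionState 2} {Ls : ℕ → ℕ}
    (h : ω.IsTorusLimitOfMixture (sectorGibbsCount n) (fun L => sectorGibbsWeightTT' β t t' U n L)
      (fun L => sectorGibbsVectorTT' t t' U n L) Ls)
    (hLs : Tendsto Ls atTop atTop) :
    ω.meanEnergy (hubbardTTPrimeFermionInteraction t t' U) 1 ∈
      Set.Icc (energyDensityTT' t t' U n) (energyDensityTT' t t' U n + Real.log 4 / β) :=
  ⟨h.energyDensityTT'_le_meanEnergy_of_sectorGibbs t t' U hn0 hn2 β hLs t' hU,
   h.meanEnergy_hubbardTTPrime_le_energyDensityTT'_add_log_four_div t t' hU hn0 hn2 hβ hLs⟩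

end InfVolFermionState

/-! ### §4 Density, `K₁`/`K₂` rows and `D` rows BY NAME for torus limits of the canonical sector
Gibbs states

The state-independent kinematic rows of `HubbardOneBodyKinematicRows` §5 (mixture torus limits of
unit fixed-density vectors) with their four bookkeeping hypotheses — weights `≥ 0` summing to `1`,
unit `rectN n L`-particle components — discharged by §2, so that the Tier-1b LP of the fast layer's
thermal (N2′) row cites one name per row: `ω.density = n`, `|K₁(ω)|, |K₂(ω)| ≤ 16/π²`
(`≤ 1.6211390`), `max(0, n − 1) ≤ D(ω) ≤ n/2`. No temperature enters (`β` arbitrary). -/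

namespace InfVolFermionState

/-- **Density of a thermal torus limit**: every torus limit `ω` of the canonical sector Gibbs states
on `(rectN n (Ls j), S^z = 0)` (`0 ≤ n ≤ 2`, `Ls → ∞`, any `β`) has particle density `ω.density = n`.
[cite: Ruelle1969, §3.4] -/
theorem IsTorusLimitOfMixture.density_eq_of_sectorGibbs
    (t t' U : ℝ) {n : ℝ} (hn0 : 0 ≤ n) (hn2 : n ≤ 2) (β : ℝ)
    {ω : InfVolFermionState 2} {Ls : ℕ → ℕ}
    (h : ω.IsTorusLimitOfMixture (sectorGibbsCount n) (fun L => sectorGibbsWeightTT' β t t' U n L)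
      (fun L => sectorGibbsVectorTT' t t' U n L) Ls)
    (hLs : Tendsto Ls atTop atTop) : ω.density = n :=
  h.density_eq_of_rectN hLs (fun L => sum_sectorGibbsWeightTT' β t t' U hn0 hn2 L) hn0
    (fun L i => isNParticle_sectorGibbsVectorTT' t t' U n L i)
    (fun L i => star_sectorGibbsVectorTT'_dotProduct_self t t' U n L i)

/-- **`K₁` rows of a thermal torus limit**: `-16/π² ≤ K₁(ω) ≤ 16/π²`, i.e.
`|e_{Φ(1,0,0)}(ω)| ≤ 16/π²`, for every torus limit of the canonical sector Gibbs states
(`0 ≤ n < 2`, `Ls → ∞`, any `β`). [cite: LiebLoss1993, §8, Theorem 8.2] [cite: Ruelle1969, §3.4] -/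
theorem IsTorusLimitOfMixture.abs_meanEnergy_nnHop_le_of_sectorGibbs
    (t t' U : ℝ) {n : ℝ} (hn0 : 0 ≤ n) (hn2 : n < 2) (β : ℝ)
    {ω : InfVolFermionState 2} {Ls : ℕ → ℕ}
    (h : ω.IsTorusLimitOfMixture (sectorGibbsCount n) (fun L => sectorGibbsWeightTT' β t t' U n L)
      (fun L => sectorGibbsVectorTT' t t' U n L) Ls)
    (hLs : Tendsto Ls atTop atTop) :
    |ω.meanEnergy (hubbardTTPrimeFermionInteraction 1 0 0) 1| ≤ 16 / Real.pi ^ 2 :=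
  h.abs_meanEnergy_nnHop_le hn0 hn2 hLs
    (fun L i => sectorGibbsWeightTT'_nonneg β t t' U n L i)
    (fun L => sum_sectorGibbsWeightTT' β t t' U hn0 hn2.le L)
    (fun L i => isNParticle_sectorGibbsVectorTT' t t' U n L i)
    (fun L i => star_sectorGibbsVectorTT'_dotProduct_self t t' U n L i)

/-- The `K₁` rows with the engine's outward decimal: `|K₁(ω)| ≤ 1.6211390` for every torus limit of
the canonical sector Gibbs states. [cite: LiebLoss1993, §8, Theorem 8.2] -/
theorem IsTorusLimitOfMixture.abs_meanEnergy_nnHop_le_decimal_of_sectorGibbs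
    (t t' U : ℝ) {n : ℝ} (hn0 : 0 ≤ n) (hn2 : n < 2) (β : ℝ)
    {ω : InfVolFermionState 2} {Ls : ℕ → ℕ}
    (h : ω.IsTorusLimitOfMixture (sectorGibbsCount n) (fun L => sectorGibbsWeightTT' β t t' U n L)
      (fun L => sectorGibbsVectorTT' t t' U n L) Ls)
    (hLs : Tendsto Ls atTop atTop) :
    |ω.meanEnergy (hubbardTTPrimeFermionInteraction 1 0 0) 1| ≤ (1.6211390 : ℝ) :=
  h.abs_meanEnergy_nnHop_le_decimal hn0 hn2 hLs
    (fun L i => sectorGibbsWeightTT'_nonneg β t t' U n L i)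
    (fun L => sum_sectorGibbsWeightTT' β t t' U hn0 hn2.le L)
    (fun L i => isNParticle_sectorGibbsVectorTT' t t' U n L i)
    (fun L i => star_sectorGibbsVectorTT'_dotProduct_self t t' U n L i)

/-- **`K₂` rows of a thermal torus limit**: `-16/π² ≤ K₂(ω) ≤ 16/π²`, i.e.
`|e_{Φ(0,1,0)}(ω)| ≤ 16/π²`, for every torus limit of the canonical sector Gibbs states
(`0 ≤ n < 2`, `Ls → ∞`, any `β`). [cite: LiebLoss1993, §8, Theorem 8.2] [cite: Ruelle1969, §3.4] -/
theorem IsTorusLimitOfMixture.abs_meanEnergy_diagHop_le_of_sectorGibbs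
    (t t' U : ℝ) {n : ℝ} (hn0 : 0 ≤ n) (hn2 : n < 2) (β : ℝ)
    {ω : InfVolFermionState 2} {Ls : ℕ → ℕ}
    (h : ω.IsTorusLimitOfMixture (sectorGibbsCount n) (fun L => sectorGibbsWeightTT' β t t' U n L)
      (fun L => sectorGibbsVectorTT' t t' U n L) Ls)
    (hLs : Tendsto Ls atTop atTop) :
    |ω.meanEnergy (hubbardTTPrimeFermionInteraction 0 1 0) 1| ≤ 16 / Real.pi ^ 2 :=
  h.abs_meanEnergy_diagHop_le hn0 hn2 hLs
    (fun L i => sectorGibbsWeightTT'_nonneg β t t' U n L i)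
    (fun L => sum_sectorGibbsWeightTT' β t t' U hn0 hn2.le L)
    (fun L i => isNParticle_sectorGibbsVectorTT' t t' U n L i)
    (fun L i => star_sectorGibbsVectorTT'_dotProduct_self t t' U n L i)

/-- The `K₂` rows with the engine's outward decimal: `|K₂(ω)| ≤ 1.6211390` for every torus limit of
the canonical sector Gibbs states. [cite: LiebLoss1993, §8, Theorem 8.2] -/
theorem IsTorusLimitOfMixture.abs_meanEnergy_diagHop_le_decimal_of_sectorGibbs
    (t t' U : ℝ) {n : ℝ} (hn0 : 0 ≤ n) (hn2 : n < 2) (β : ℝ)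
    {ω : InfVolFermionState 2} {Ls : ℕ → ℕ}
    (h : ω.IsTorusLimitOfMixture (sectorGibbsCount n) (fun L => sectorGibbsWeightTT' β t t' U n L)
      (fun L => sectorGibbsVectorTT' t t' U n L) Ls)
    (hLs : Tendsto Ls atTop atTop) :
    |ω.meanEnergy (hubbardTTPrimeFermionInteraction 0 1 0) 1| ≤ (1.6211390 : ℝ) :=
  h.abs_meanEnergy_diagHop_le_decimal hn0 hn2 hLs
    (fun L i => sectorGibbsWeightTT'_nonneg β t t' U n L i)
    (fun L => sum_sectorGibbsWeightTT' β t t' U hn0 hn2.le L)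
    (fun L i => isNParticle_sectorGibbsVectorTT' t t' U n L i)
    (fun L i => star_sectorGibbsVectorTT'_dotProduct_self t t' U n L i)

/-- **Lower `D` rows of a thermal torus limit**: `max(0, n − 1) ≤ D(ω) = e_{Φ(0,0,1)}(ω)` for every
torus limit of the canonical sector Gibbs states (`0 ≤ n ≤ 2`, `Ls → ∞`, any `β`).
[cite: KomaTasaki1994, §1] [cite: Ruelle1969, §3.4] -/
theorem IsTorusLimitOfMixture.max_zero_density_sub_one_le_docc_of_sectorGibbs
    (t t' U : ℝ) {n : ℝ} (hn0 : 0 ≤ n) (hn2 : n ≤ 2) (β : ℝ)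
    {ω : InfVolFermionState 2} {Ls : ℕ → ℕ}
    (h : ω.IsTorusLimitOfMixture (sectorGibbsCount n) (fun L => sectorGibbsWeightTT' β t t' U n L)
      (fun L => sectorGibbsVectorTT' t t' U n L) Ls)
    (hLs : Tendsto Ls atTop atTop) :
    max 0 (n - 1) ≤ ω.meanEnergy (hubbardTTPrimeFermionInteraction 0 0 1) 1 :=
  max_le (h.docc_nonneg hLs)
    (h.density_sub_one_le_docc hn0 hLs (fun L => sum_sectorGibbsWeightTT' β t t' U hn0 hn2 L)
      (fun L i => isNParticle_sectorGibbsVectorTT' t t' U n L i)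
      (fun L i => star_sectorGibbsVectorTT'_dotProduct_self t t' U n L i))

/-- **Upper `D` row of a thermal torus limit**: `D(ω) ≤ n/2` for every torus limit of the canonical
sector Gibbs states (`0 ≤ n ≤ 2`, `Ls → ∞`, any `β`; no `S^z` hypothesis used).
[cite: Ruelle1969, §3.4] -/
theorem IsTorusLimitOfMixture.docc_le_half_density_of_sectorGibbs
    (t t' U : ℝ) {n : ℝ} (hn0 : 0 ≤ n) (hn2 : n ≤ 2) (β : ℝ)
    {ω : InfVolFermionState 2} {Ls : ℕ → ℕ}
    (h : ω.IsTorusLimitOfMixture (sectorGibbsCount n) (fun L => sectorGibbsWeightTT' β t t' U n L)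
      (fun L => sectorGibbsVectorTT' t t' U n L) Ls)
    (hLs : Tendsto Ls atTop atTop) :
    ω.meanEnergy (hubbardTTPrimeFermionInteraction 0 0 1) 1 ≤ n / 2 :=
  h.docc_le_half_density hn0 hLs (fun L => sum_sectorGibbsWeightTT' β t t' U hn0 hn2 L)
    (fun L i => isNParticle_sectorGibbsVectorTT' t t' U n L i)
    (fun L i => star_sectorGibbsVectorTT'_dotProduct_self t t' U n L i)

/-- **The `D` window of a thermal torus limit**: `D(ω) ∈ [max(0, n − 1), n/2]` for every torus limit
of the canonical sector Gibbs states (`0 ≤ n ≤ 2`, `Ls → ∞`, any `β`).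
[cite: KomaTasaki1994, §1] [cite: Ruelle1969, §3.4] -/
theorem IsTorusLimitOfMixture.docc_mem_Icc_of_sectorGibbs
    (t t' U : ℝ) {n : ℝ} (hn0 : 0 ≤ n) (hn2 : n ≤ 2) (β : ℝ)
    {ω : InfVolFermionState 2} {Ls : ℕ → ℕ}
    (h : ω.IsTorusLimitOfMixture (sectorGibbsCount n) (fun L => sectorGibbsWeightTT' β t t' U n L)
      (fun L => sectorGibbsVectorTT' t t' U n L) Ls)
    (hLs : Tendsto Ls atTop atTop) :
    ω.meanEnergy (hubbardTTPrimeFermionInteraction 0 0 1) 1 ∈ Set.Icc (max 0 (n - 1)) (n / 2) :=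
  ⟨h.max_zero_density_sub_one_le_docc_of_sectorGibbs t t' U hn0 hn2 β hLs,
   h.docc_le_half_density_of_sectorGibbs t t' U hn0 hn2 β hLs⟩

/-- The same `D` window for the double-occupancy EXPECTATION `Re ω(n_{0↑} n_{0↓})` (the form the
slopes/cut rows use; `meanEnergy_onSite_eq_re_expect_docc`). [cite: KomaTasaki1994, §1] -/
theorem IsTorusLimitOfMixture.re_expect_docc_mem_Icc_of_sectorGibbs
    (t t' U : ℝ) {n : ℝ} (hn0 : 0 ≤ n) (hn2 : n ≤ 2) (β : ℝ)
    {ω : InfVolFermionState 2} {Ls : ℕ → ℕ}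
    (h : ω.IsTorusLimitOfMixture (sectorGibbsCount n) (fun L => sectorGibbsWeightTT' β t t' U n L)
      (fun L => sectorGibbsVectorTT' t t' U n L) Ls)
    (hLs : Tendsto Ls atTop atTop) :
    (ω.expect ({0} : Finset (Site 2))
        (nAt 0 (Finset.mem_singleton_self 0) 0 * nAt 0 (Finset.mem_singleton_self 0) 1)).re ∈
      Set.Icc (max 0 (n - 1)) (n / 2) := by
  rw [← h.meanEnergy_onSite_eq_re_expect_docc hLs]
  exact h.docc_mem_Icc_of_sectorGibbs t t' U hn0 hn2 β hLs

end InfVolFermionState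

/-! ### §5 The binomial entropy bound: `log #sector ≤ 2 L² H_b(k_L/L²)` and the cap with
`s = 2·H_b(n/2)` (planner-p2's `s_max(n)`, the version the dilute census rows cite) -/

section BinomialEntropy

/-- **Binomial coefficients are bounded by the binary entropy**: `log C(m,k) ≤ m · H_b(k/m)` for
`k ≤ m`, `H_b` = Mathlib's `Real.binEntropy` (nats). This is the tree's
`Literature.Analysis.SpecialFunctions.log_choose_le_entropy` (`log C(m,k) ≤ m log m − k log k − (m−k) log(m−k)`,
one term of `(p + (1−p))^m = 1`) rewritten in entropy form; a Summits-side copy of this rewriting exists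
(`…TwSeededEnsembleEquivalenceR.HotWindow.log_choose_le_mul_binEntropy`, not importable here).
[cite: Israel1979, Lemma II.3.1] -/
theorem log_choose_le_mul_binEntropy {m k : ℕ} (hkm : k ≤ m) :
    Real.log (m.choose k) ≤ (m : ℝ) * Real.binEntropy ((k : ℝ) / m) := by
  have h := Literature.Analysis.SpecialFunctions.log_choose_le_entropy hkm
  rcases Nat.eq_zero_or_pos k with hk0 | hkpos
  · subst hk0
    simp
  rcases eq_or_lt_of_le hkm with hkm' | hklt
  · subst hkm'
    have hm : (k : ℝ) ≠ 0 := by exact_mod_cast hkpos.ne'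
    rw [Nat.choose_self, div_self hm]
    simp
  have hmR : (0 : ℝ) < m := by exact_mod_cast lt_of_lt_of_le hkpos hkm
  have hkR : (0 : ℝ) < k := by exact_mod_cast hkpos
  have hmkR : (0 : ℝ) < (m : ℝ) - k := by
    have : (k : ℝ) < m := by exact_mod_cast hklt
    linarith
  -- `m H_b(k/m) = m log m − k log k − (m − k) log (m − k)`
  have hid : (m : ℝ) * Real.binEntropy ((k : ℝ) / m) =
      m * Real.log m - k * Real.log k - ((m : ℝ) - k) * Real.log ((m : ℝ) - k) := by
    have h1 : 1 - (k : ℝ) / m = ((m : ℝ) - k) / m := by field_simp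
    rw [Real.binEntropy, h1, inv_div, inv_div, Real.log_div hmR.ne' hkR.ne',
      Real.log_div hmR.ne' hmkR.ne']
    field_simp
    ring
  rw [hid]
  exact h

/-- **The sector dimension is at most `C(L², k)²`**, `k = ⌊nL²/2⌋` (a configuration is determined by
its up- and down-spin site sets, both of cardinality `k`). [cite: LiebPRL1989, proof of Theorem 1] -/
theorem sectorGibbsCount_le_choose_sq (n : ℝ) (L : ℕ) :
    sectorGibbsCount n L ≤ ((L ^ 2).choose (halfRectN n L)) ^ 2 := by
  classical
  set k := halfRectN n L with hk
  let f : Subtype (szConfig n L) →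
      {α : Finset (FermionTorus 2 L) // α.card = k} × {β : Finset (FermionTorus 2 L) // β.card = k} :=
    fun s => (⟨upPart s.1, s.2.1⟩, ⟨downPart s.1, s.2.2⟩)
  have hf : Function.Injective f := by
    rintro ⟨s, hs⟩ ⟨s', hs'⟩ h
    simp only [f, Prod.mk.injEq, Subtype.mk.injEq] at h
    apply Subtype.ext
    show s = s'
    rw [← pairSet_upPart_downPart s, ← pairSet_upPart_downPart s', h.1, h.2]
  have hcard := Fintype.card_le_of_injective f hf
  rw [Fintype.card_prod, Fintype.card_finset_len] at hcard
  have hΛ : Fintype.card (FermionTorus 2 L) = L ^ 2 := by simp [FermionTorus, sq]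
  rw [hΛ, ← sq] at hcard
  exact hcard

/-- **Binomial entropy bound for the sector**: `log #sector ≤ 2 L² · H_b(k/L²)`, `k = ⌊nL²/2⌋`
(`0 ≤ n ≤ 2`). [cite: Israel1979, Lemma II.3.1] -/
theorem log_sectorGibbsCount_le_binEntropy {n : ℝ} (hn0 : 0 ≤ n) (hn2 : n ≤ 2) (L : ℕ) :
    Real.log (sectorGibbsCount n L) ≤
      2 * (L : ℝ) ^ 2 * Real.binEntropy ((halfRectN n L : ℝ) / (L : ℝ) ^ 2) := by
  have hk : halfRectN n L ≤ L ^ 2 := by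
    have h := halfRectN_le_card hn0 hn2 L
    have hΛ : Fintype.card (FermionTorus 2 L) = L ^ 2 := by simp [FermionTorus, sq]
    rwa [hΛ] at h
  have hpos : 0 < sectorGibbsCount n L := by
    obtain ⟨s, hs⟩ := exists_szConfig hn0 hn2 L
    exact Fintype.card_pos_iff.2 ⟨⟨s, hs⟩⟩
  have hchoose : (0 : ℝ) < (L ^ 2).choose (halfRectN n L) := by exact_mod_cast Nat.choose_pos hk
  calc Real.log (sectorGibbsCount n L)
      ≤ Real.log ((((L ^ 2).choose (halfRectN n L)) ^ 2 : ℕ) : ℝ) :=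
        Real.log_le_log (by exact_mod_cast hpos) (by exact_mod_cast sectorGibbsCount_le_choose_sq n L)
    _ = 2 * Real.log ((L ^ 2).choose (halfRectN n L)) := by
        rw [Nat.cast_pow, Real.log_pow]; norm_num
    _ ≤ 2 * (((L ^ 2 : ℕ) : ℝ) * Real.binEntropy ((halfRectN n L : ℝ) / ((L ^ 2 : ℕ) : ℝ))) :=
        mul_le_mul_of_nonneg_left (log_choose_le_mul_binEntropy hk) (by norm_num)
    _ = 2 * (L : ℝ) ^ 2 * Real.binEntropy ((halfRectN n L : ℝ) / (L : ℝ) ^ 2) := by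
        push_cast; ring

/-- `k_L/L² → n/2`: the sector filling fraction converges. [folklore] -/
private theorem tendsto_halfRectN_div_sq {n : ℝ} (hn0 : 0 ≤ n) :
    Tendsto (fun L : ℕ => (halfRectN n L : ℝ) / (L : ℝ) ^ 2) atTop (𝓝 (n / 2)) := by
  have h := (tendsto_rectN_div_sq hn0).div_const 2
  refine h.congr fun L => ?_
  rw [rectN_eq_two_mul_halfRectN]
  push_cast
  ring

/-- **Eventually `log #sector_L ≤ s·L²` for every `s > 2 H_b(n/2)`** (`0 ≤ n ≤ 2`; continuity of the
binary entropy at `n/2`). [cite: Israel1979, Lemma II.3.1] -/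
theorem eventually_log_sectorGibbsCount_le {n : ℝ} (hn0 : 0 ≤ n) (hn2 : n ≤ 2) {s : ℝ}
    (hs : 2 * Real.binEntropy (n / 2) < s) :
    ∀ᶠ L : ℕ in atTop, Real.log (sectorGibbsCount n L) ≤ s * (L : ℝ) ^ 2 := by
  have hcont : Tendsto (fun L : ℕ => 2 * Real.binEntropy ((halfRectN n L : ℝ) / (L : ℝ) ^ 2)) atTop
      (𝓝 (2 * Real.binEntropy (n / 2))) :=
    ((Real.binEntropy_continuous.tendsto _).comp (tendsto_halfRectN_div_sq hn0)).const_mul 2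
  filter_upwards [hcont.eventually (gt_mem_nhds hs)] with L hL
  have hL2 : (0 : ℝ) ≤ (L : ℝ) ^ 2 := sq_nonneg _
  calc Real.log (sectorGibbsCount n L)
      ≤ 2 * (L : ℝ) ^ 2 * Real.binEntropy ((halfRectN n L : ℝ) / (L : ℝ) ^ 2) :=
        log_sectorGibbsCount_le_binEntropy hn0 hn2 L
    _ = (2 * Real.binEntropy ((halfRectN n L : ℝ) / (L : ℝ) ^ 2)) * (L : ℝ) ^ 2 := by ring
    _ ≤ s * (L : ℝ) ^ 2 := mul_le_mul_of_nonneg_right hL.le hL2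

end BinomialEntropy

namespace InfVolFermionState

/-- **The N2′ CAP row with the binomial entropy constant `s_max(n) = 2·H_b(n/2)`**: for every torus
limit `ω` of the canonical sector Gibbs states at inverse temperature `β > 0` (`U ≥ 0`, `0 ≤ n < 2`,
`Ls → ∞`), `e_{Φ(t,t',U)}(ω) ≤ e(t,t',U,n) + 2·H_b(n/2)/β` (`H_b` = Mathlib's `Real.binEntropy`, nats;
`2 H_b(7/16) = 1.37063…`, `2 H_b(1/2) = log 4`). [cite: Israel1979, Lemma II.3.1] [cite: Ruelle1969, §3.4] -/
theorem IsTorusLimitOfMixture.meanEnergy_hubbardTTPrime_le_energyDensityTT'_add_binEntropy_div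
    (t t' : ℝ) {U : ℝ} (hU : 0 ≤ U) {n : ℝ} (hn0 : 0 ≤ n) (hn2 : n < 2) {β : ℝ} (hβ : 0 < β)
    {ω : InfVolFermionState 2} {Ls : ℕ → ℕ}
    (h : ω.IsTorusLimitOfMixture (sectorGibbsCount n) (fun L => sectorGibbsWeightTT' β t t' U n L)
      (fun L => sectorGibbsVectorTT' t t' U n L) Ls)
    (hLs : Tendsto Ls atTop atTop) :
    ω.meanEnergy (hubbardTTPrimeFermionInteraction t t' U) 1 ≤
      energyDensityTT' t t' U n + 2 * Real.binEntropy (n / 2) / β := by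
  refine le_of_forall_pos_le_add fun ε hε => ?_
  have hs : 2 * Real.binEntropy (n / 2) < 2 * Real.binEntropy (n / 2) + β * ε := by
    linarith [mul_pos hβ hε]
  have hev := hLs.eventually (eventually_log_sectorGibbsCount_le hn0 hn2.le hs)
  have hcap := h.meanEnergy_hubbardTTPrime_le_energyDensityTT'_add_of_sectorGibbs t t' hU hn0 hn2 hβ
    hLs hev
  have hsplit : (2 * Real.binEntropy (n / 2) + β * ε) / β = 2 * Real.binEntropy (n / 2) / β + ε := by
    rw [add_div, mul_div_assoc, mul_div_cancel_left₀ ε hβ.ne']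
  linarith [hcap, hsplit]

end InfVolFermionState

/-! ### §6 The outward decimal at the headline density `n = 7/8`: `2·H_b(7/16) < 1.371`, and the
N2′ cap row `e_Φ(ω) ≤ e(t,t',U,7/8) + 1.371/β` by name -/

section HeadlineDecimal

/-- `2 log 2 + (log 3)/2 + 1/98 ≤ log 7`: `2 log 7 = log 48 + log(49/48)`, `log 48 = 4 log 2 + log 3`
and `log x ≥ 1 − 1/x` at `x = 49/48`. (True values `1.94580…  ≤ 1.94591…`.) [folklore] -/
private theorem two_mul_log_two_add_half_log_three_add_le_log_seven :
    2 * Real.log 2 + Real.log 3 / 2 + 1 / 98 ≤ Real.log 7 := by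
  have h49 : Real.log 49 = 2 * Real.log 7 := by
    rw [show (49 : ℝ) = 7 ^ 2 by norm_num, Real.log_pow]; norm_num
  have h48 : Real.log 48 = 4 * Real.log 2 + Real.log 3 := by
    rw [show (48 : ℝ) = 2 ^ 4 * 3 by norm_num, Real.log_mul (by norm_num) (by norm_num), Real.log_pow]
    norm_num
  have hq : 1 - (49 / 48 : ℝ)⁻¹ ≤ Real.log (49 / 48) := Real.one_sub_inv_le_log_of_pos (by norm_num)
  have hdiv : Real.log (49 / 48) = Real.log 49 - Real.log 48 :=
    Real.log_div (by norm_num) (by norm_num)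
  rw [hdiv, h49, h48] at hq
  norm_num at hq
  linarith

/-- **`2·H_b(7/16) < 1371/1000`** (`H_b` = Mathlib's `Real.binEntropy`, nats; true value
`1.370628…`): `2 H_b(7/16) = 8 log 2 − (7/8) log 7 − (9/4) log 3`, bounded with Mathlib's
`Real.log_two_lt_d9`, `Real.log_three_gt_d9` and `log 7 ≥ 2 log 2 + (log 3)/2 + 1/98`
(giving `≤ 1.370721`). This is planner-p2's printed entropy constant `s = 1371/1000` at the headline
density `n = 7/8` (`s_max(7/8) = 2 H_b(7/16)`); kept private (a numerical helper — the citable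
statements are the cap rows below). [folklore] -/
private theorem two_mul_binEntropy_seven_div_sixteen_lt :
    2 * Real.binEntropy (7 / 16) < 1371 / 1000 := by
  have hid : 2 * Real.binEntropy (7 / 16) =
      8 * Real.log 2 - 7 / 8 * Real.log 7 - 9 / 4 * Real.log 3 := by
    have h16 : Real.log 16 = 4 * Real.log 2 := by
      rw [show (16 : ℝ) = 2 ^ 4 by norm_num, Real.log_pow]; norm_num
    have h9 : Real.log 9 = 2 * Real.log 3 := by
      rw [show (9 : ℝ) = 3 ^ 2 by norm_num, Real.log_pow]; norm_num
    rw [Real.binEntropy, show (1 - 7 / 16 : ℝ) = 9 / 16 by norm_num, inv_div, inv_div,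
      Real.log_div (by norm_num) (by norm_num), Real.log_div (by norm_num) (by norm_num), h16, h9]
    ring
  rw [hid]
  linarith [Real.log_two_lt_d9, Real.log_three_gt_d9,
    two_mul_log_two_add_half_log_three_add_le_log_seven]

/-- The same decimal in the form the cap rows consume: `2·H_b((7/8)/2) ≤ 1371/1000`. [folklore] -/
private theorem two_mul_binEntropy_half_seven_div_eight_le :
    2 * Real.binEntropy (7 / 8 / 2) ≤ 1371 / 1000 := by
  rw [show (7 / 8 / 2 : ℝ) = 7 / 16 by norm_num]
  exact two_mul_binEntropy_seven_div_sixteen_lt.le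

end HeadlineDecimal

namespace InfVolFermionState

/-- **The N2′ CAP row at the headline density `n = 7/8` with the printed constant `s = 1.371`**:
for every torus limit `ω` of the canonical sector Gibbs states on `(rectN (7/8) (Ls j), S^z = 0)` at
inverse temperature `β > 0` (`U ≥ 0`, `Ls → ∞`),
`e_{Φ(t,t',U)}(ω) ≤ e(t,t',U,7/8) + (1371/1000)/β` (`…_add_binEntropy_div` at `n = 7/8` and
`2 H_b(7/16) < 1.371`). [cite: Israel1979, Lemma II.3.1] [cite: Ruelle1969, §3.4] -/
theorem IsTorusLimitOfMixture.meanEnergy_hubbardTTPrime_le_energyDensityTT'_add_decimal_div_of_seven_div_eight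
    (t t' : ℝ) {U : ℝ} (hU : 0 ≤ U) {β : ℝ} (hβ : 0 < β)
    {ω : InfVolFermionState 2} {Ls : ℕ → ℕ}
    (h : ω.IsTorusLimitOfMixture (sectorGibbsCount (7 / 8))
      (fun L => sectorGibbsWeightTT' β t t' U (7 / 8) L)
      (fun L => sectorGibbsVectorTT' t t' U (7 / 8) L) Ls)
    (hLs : Tendsto Ls atTop atTop) :
    ω.meanEnergy (hubbardTTPrimeFermionInteraction t t' U) 1 ≤
      energyDensityTT' t t' U (7 / 8) + 1371 / 1000 / β := by
  have hcap := h.meanEnergy_hubbardTTPrime_le_energyDensityTT'_add_binEntropy_div t t' hU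
    (by norm_num) (by norm_num) hβ hLs
  have hdec : 2 * Real.binEntropy (7 / 8 / 2) / β ≤ 1371 / 1000 / β :=
    div_le_div_of_nonneg_right two_mul_binEntropy_half_seven_div_eight_le hβ.le
  exact hcap.trans (by linarith)

/-- The two-sided energy window of a thermal torus limit at `n = 7/8` with the printed constant:
`e(t,t',U,7/8) ≤ e_{Φ(t,t',U)}(ω) ≤ e(t,t',U,7/8) + 1.371/β`.
[cite: Israel1979, Lemma II.3.1] [cite: Ruelle1969, §3.4] -/
theorem IsTorusLimitOfMixture.meanEnergy_hubbardTTPrime_mem_Icc_decimal_of_seven_div_eight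
    (t t' : ℝ) {U : ℝ} (hU : 0 ≤ U) {β : ℝ} (hβ : 0 < β)
    {ω : InfVolFermionState 2} {Ls : ℕ → ℕ}
    (h : ω.IsTorusLimitOfMixture (sectorGibbsCount (7 / 8))
      (fun L => sectorGibbsWeightTT' β t t' U (7 / 8) L)
      (fun L => sectorGibbsVectorTT' t t' U (7 / 8) L) Ls)
    (hLs : Tendsto Ls atTop atTop) :
    ω.meanEnergy (hubbardTTPrimeFermionInteraction t t' U) 1 ∈
      Set.Icc (energyDensityTT' t t' U (7 / 8)) (energyDensityTT' t t' U (7 / 8) + 1371 / 1000 / β) :=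
  ⟨h.energyDensityTT'_le_meanEnergy_of_sectorGibbs t t' U (by norm_num) (by norm_num) β hLs t' hU,
   h.meanEnergy_hubbardTTPrime_le_energyDensityTT'_add_decimal_div_of_seven_div_eight t t' hU hβ hLs⟩

end InfVolFermionState

end Literature.MathematicalPhysics.QuantumLattice
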